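import Mathlib
import HarnessLib
import HarnessLib.Audit
import Summits.RiemannHypothesis.Statement
import Summits.RiemannHypothesis.RiemannHypothesis.Theorems.Splittings.ScrewLatticeContinuationB
import HarnessLib.Audit.Status.Attr

/-!
Route: ScrewPorousWall

# Route ScrewPorousWall — X-12 POROUS WALL — under CEIL no aliased pole is porously accessible; one
porous far zero plus CEIL(1) gives RH

D-0145 LINE of seat rh-idea-1 (technique: splitting / criterion search — the director's «one RH-free
dichotomy lemma line»; bears_on
LADDER-RH rung S-P «search for NEW splits (screw §19 ff.)», column SCREW §19–20). It suffices to
show X = X-12: NoPorousPole ∧ PorousPole(1)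
∧ CEIL(1) ⟹ RH, where the PROVABLE content is the RH-free theorem `NoPorousPole`: for every h > 0,
under CEIL(h) no aliased pole p (a folded
far zero e^{∓(ρ−1/2)h} inside 𝔻) admits a POROUS ACCESS from the origin's component Ω₀ of 𝔻 ∖
closure(aliasedPoleSet h) — a sequence
z_n → p in Ω₀ with ‖q − z_n‖ ≥ κ‖z_n − p‖ for all other wall points q (κ > 0 fixed). This is the
local Stolz/Brown–Shields–Zeller necessity:
the p-term of the sign-definite Borel series blows up along z_n while porosity keeps the ℓ¹-tail of
the neighbouring poles at bay. The
zero-side conjunct `PorousPole` («some aliased pole is porously accessible, if any exists»;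
RH-implied vacuously) and the declared RESIDUAL
`Ceil` = CEIL(1) complete the split; RH ⟹ all three. NoPorousPole strictly generalises the §19 WALLS
theorem (isolated ⟹ porously accessible)
in a direction incomparable with §20's circles / g16's ThinWall (metric size) and with X-11's
DustWall (topology): porosity is a LOCAL GEOMETRIC
condition at one pole. Nothing here bears on the truth of RH.
Lean: `Summit.RiemannHypothesis.RiemannHypothesis.Theses.ScrewPorousWall.NoPorousPole →
Summit.RiemannHypothesis.RiemannHypothesis.Theses.ScrewPorousWall.PorousPole →
Summit.RiemannHypothesis.RiemannHypothesis.Theses.ScrewPorousWall.Ceil → Summit.RiemannHypothesis`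

## Assembly
Pure logic, kernel-checked in the seat folder (Sketch.lean `ScrewPorousWall.closes`, 4 lines, rc 0):
by_contra ¬RH ⟹
`aliasedPoleSet_nonempty_of_not_rh one_pos` ⟹ PorousPole yields (p, κ, z) ⟹ NoPorousPole 1 one_pos
Ceil p … gives False. The deciding theorem is
`closes (h₁ h₂ h₃) (hA : Assembly) := hA h₁ h₂ h₃`; the Assembly item is PROVABLE NOW (proof text
attached as evidence at birth).

Rationale: WHY THIS LINE. Mechanism: on Ω₀ the lattice generating function F = `latticeGF h` (holomorphic on 𝔻
under CEIL(h), `differentiableOn_latticeGF`) equals the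
Borel sum B = Σ_ρ term(coeff ρ, mult h ρ) (`latticeGF_eq_borel` +
`ScrewBorelFlux.eqOn_of_preconnected` with V = Ω₀); along a porous access
z_n → p one has |B(z_n)|·‖z_n − p‖ ≥ |C_p|·‖p‖ − ε(η)/κ − O_η(‖z_n − p‖) with C_p the (non-zero,
`re_tsum_poleCoeff_neg`) charge of the fibre over
p and ε(η) → 0 the ℓ¹-mass of poles within η of p, so |F(z_n)| → ∞ against continuity of F at p ∈ 𝔻.
Imported from function theory:
the role of non-tangential / dominating approach in Borel-series non-continuation (Bonsall,
Brown–Shields–Zeller; Ross–Shapiro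
doi:10.1090/ulect/025 ch. 4 pp36–37 [corpus:book:ross2002-generalized-analytic-continuation p36])
localised to ONE pole, with porosity in
the sense of Zajíček [corpus:paper:doi-10-1155-aaa-2005-509 p2] as the access condition. What it
does that listed routes do not: L1
(g16, ThinWall) and §20 need a whole CIRCLE free of the wall, X-9 needs an ISOLATED pole, X-11 (this
seat's ScrewDustWall) needs a wall-free
CYCLE; a porous access needs only a κ-cone-like corridor and survives walls that are locally
connected through p (e.g. p an endpoint of an
arc of the wall), so the conjunct PorousPole is not implied by, nor implies, TW/TD — a genuinely
different searchable object (a porosity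
corridor at one folded far zero). The negatives index concerns other objects (ShiftedResolvent,
CharacterSums, UniversalFactor, screw-neg floors).

RANKED CRUXES. #2 NoPorousPole (crux) — RH-free theorem about ζ (the provable content). For every h
> 0 with CEIL(h): for every aliased pole p ∈ aliasedPoleSet h, every κ > 0 and every sequence z : ℕ
→ ℂ with z_n → p, z_n in the connected component of 0 in 𝔻 ∖ closure(aliasedPoleSet h), and κ‖z_n −
p‖ ≤ ‖q − z_n‖ for all n and all q ∈ closure(aliasedPoleSet h) with q ≠ p — contradiction. Proof
plan: F = B on Ω₀ (tree `eqOn_of_preconnected`, `isPreconnected_connectedComponentIn`,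
`zero_mem_ball_diff_closure`); split B(z_n) = fibre(p) + near(η) + far(η) + regular; fibre =
C_p·p/(p − z_n) (+ the u-side partner bounded), |near| ≤ ε(η)/(κ‖z_n − p‖) by porosity, far and
regular O_η(1) for ‖z_n − p‖ < η/2 (`exp_neg_half_le_norm_of_mem` keeps poles off 0); choose η with
ε(η) < κ|C_p|‖p‖/2 (`summable_norm_coeff`); then |F(z_n)| → ∞, contradicting `ContinuousAt F p`.
[difficulty: M] (why it might fail: Needs the fibre charge C_p ≠ 0 (sign-definiteness gives it) AND
a near-tail bound ε(η)/κ over ALL poles q ≠ p within η; if other folded zeros q_m → p faster than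
their coefficients decay, the near/fibre split must be by ℓ¹-tails, not pointwise — Lean cost: tsum
surgery.) [corpus:book:ross2002-generalized-analytic-continuation p36-37, doi:10.1090/ulect/025,
corpus:paper:doi-10-1155-aaa-2005-509 p2]
#3 PorousPole (crux) — The zero-side conjunct «A POROUSLY ACCESSIBLE FAR ZERO» at step h = 1 (the
searchable object): if the aliased pole field aliasedPoleSet 1 is non-empty then some aliased pole p
admits κ > 0 and a sequence z_n → p inside the origin's component of 𝔻 ∖ closure(aliasedPoleSet 1)
with κ‖z_n − p‖ ≤ ‖q − z_n‖ for every other wall point q. RH-implied (the field is empty under RH,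
`aliasedPoleSet_eq_empty_of_rh`); implied by «finitely many off-line zeros» and by CountableClosure
(an isolated pole on ∂Ω₀ exists by Baire, tree §19 `exists_isolated_mem_closure` pattern); NOT
implied by ThinWall/DustWall and not implying them. [difficulty: open-problem] (why it might fail:
False iff ¬RH and EVERY folded far zero is non-porous from Ω₀: either a continuum of the wall
separates all poles from 0 (B16′-type circle of accumulation) or each pole is wrapped in shells of
other folded zeros with relative gaps → 0; ζ-side nothing is known.)
[corpus:book:ross2002-generalized-analytic-continuation p33, doi:10.1090/ulect/025]
#9 Ceil (support) — RESIDUAL conjunct (declared, NOT attacked; RH-strength inside the real-weight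
zero-side class by the blind models B14/B16/B16′): CEIL(1) = LatticeCeiling 1 (|Ψ(k)| ≤ K_ε e^{εk}
on ℕ for every ε > 0). RH ⟹ CEIL(1) in the tree. Identical signature to ScrewDustWall.Ceil (dedup
intended). [difficulty: open-problem] [corpus:book:ross2002-generalized-analytic-continuation p33]

TWO-LAYER PLAN. NoPorousPole ⇐ (N1) kernel form over an arbitrary sign-definite ℓ¹ Borel family (c,
u) with F holomorphic on 𝔻 and agreement near 0 (pattern of
`ScrewBorel.not_mem_closure_of_isolated`) → (N2) the ℓ¹ near/far tail split `∀ η>0, Σ_{i : pole of i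
within η of p, ≠ p} ‖c_i‖ → 0` → NoPorousPole by the tree dictionary (coeff, mult h, latticeGF,
`differentiableOn_latticeGF`, `latticeGF_eq_borel`).

KILL CRITERIA. A refutation of NoPorousPole (a CEIL-consistent configuration — necessarily a kernel
blind model, constructors `ScrewLatticeWolffData/Model`, B16′ divisor rings — with a porously
accessible pole and holomorphic F) closes the route `refuted:NoPorousPole` and kills the lever.
Refutation of PorousPole is ¬RH-type information. If X-11/X-10 close their attacked conjuncts the
line is not mooted (incomparable conjunct) but loses priority. A proof that porous accessibility of
some pole follows from ThinWall would merge this line into L1 as its mechanism.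

NOT DECOMPOSED YET. The kernel-level statement (N1) and the tail lemma (N2) are layer-2 children for
the prover who claims NoPorousPole; the u-side/partner-pole bookkeeping (p = mult or p = mult⁻¹) is
routine and not filed. No quantitative rate is needed.

CHEAPEST FALSIFIER. (i) Costume/tautology: `#h21_crux_probe` with summit :=
Summit.RiemannHypothesis, ran 2026-08-27T20:4xZ — NoPorousPole CLEAN (all batteries incl. P3),
PorousPole CLEAN, Ceil CLEAN; no binder implies RH cheaply. (ii) Instrument row that would refute
the key lemma: the B16′ divisor-ring constructor (`exists_blind_model_discrete`): its wall is a
circle of accumulation points plus poles converging radially to it from both sides — check that no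
pole of that model is porously accessible from Ω₀ (each pole there is isolated but Ω₀ = the inner
disc does not reach the outer poles; inner poles ARE isolated and adherent to Ω₀ — so the model must
be non-blind on the inner side: consistent, since B16′ is blind only for the ANNULAR region;
recorded as the first refuter exercise). (iii) PorousPole alone ⇏ RH: «finitely many off-line zeros»
is a consistent separating scenario (every pole isolated ⟹ porous) in which RH fails — CEIL is
load-bearing.

NUMBERS. h = 1 for the conjunct and residual; poles satisfy e^{-1/2} ≤ ‖p‖ < 1; κ is existential
(any κ > 0 works in NoPorousPole — no hand-picked threshold, checklist 4c(iv)).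

DEFINITION REQUESTS. None (porosity is spelled out inline; `connectedComponentIn`, `Filter.Tendsto`,
`Metric.ball` are Mathlib; `aliasedPoleSet`, `LatticeCeiling` are tree decls).

Novelty: Searches (2026-08-27): lit search --hybrid "porous set pole cannot be cancelled Borel series
nontangential approach dominating sequence" (6 docs, none relevant); lit read
book:ross2002-generalized-analytic-continuation --grep 'porous|totally disconnected|Zoretti' (0
lines) and rg 'non-tangential|dominating|Brown' (Bonsall Prop 4.2.9 p36, BSZ Thm 4.2.12 p37, Wolff
p33); lit search '"porous" "porosity" set' --source local (5 docs: doi:10.1155/AAA.2005.509 Zajíček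
p2–3, doi:10.1155/2009/243604, arXiv:1209.4491); lit galaxy search "Zoretti" --star all (14 rows,
none on Borel series); ledger negatives --problem RiemannHypothesis (4, unrelated); tree rg
Theorems/Splittings for isolated|small_circles|dichotomy (no porosity / sequence-access statement).
Nearest prior art found: tree
`ScrewLatticeContinuation.not_mem_closure_of_isolated_of_latticeCeiling` (§19 WALLS, isolated pole)
and Ross–Shapiro doi:10.1090/ulect/025 Thm 4.2.12 (Brown–Shields–Zeller: non-continuation needs
non-tangentially dense poles, a GLOBAL boundary condition).
Delta: localises the dominating-sequence/non-tangential mechanism to a single pole as a porosity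
corridor inside the regular component, giving an RH-free lemma strictly stronger than WALLS and a
conjunct (one porously accessible folded far zero) incomparable with every metric/topological wall
conjunct on the ladder.
Claimed grade: new-combination  [refs: 10.1155/AAA.2005.509, 10.1155/2009/243604, 10.1090/ulect/025, 1209.4491, book:ross2002-generalized-analytic-continuation, doi:10.1155/AAA.2005.509, doi:10.1155/2009/243604, doi:10.1090/ulect/025]

Barriers (technique_class: splitting, criterion-search, borel-continuation): - technique_class: splitting, criterion-search, borel-continuation
- Literature.Barriers.RiemannHypothesis.DavenportHeilbronn: outside — no zero-free region is
claimed; the criterion runs through ζ's own explicit-formula dictionary (`latticeGF_eq_borel`); for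
a Davenport–Heilbronn function CEIL fails generically, so off-line DH zeros contradict nothing here.
- Literature.Barriers.RiemannHypothesis.BrouckeDebruyneRevesz2023_thm13: outside (Beurling-type
counterexamples) — no Euler product / Beurling-prime input is used; NoPorousPole is a statement
about one fixed Dirichlet-type Borel family.
- Literature.Barriers.RiemannHypothesis.BohrDenseValues: outside — no value-distribution /
density-of-values input is used; the invisibility results that DO bear on this class are the tree
blind models B14/B16/B16′ (`ScrewLatticeWolffModel.exists_blind_model`,
`exists_blind_model_discrete`), honoured: CEIL alone stays residual, and in every known blind model
no pole is porously accessible from the blind region (walls are full circles / annuli).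
- Negatives index: none of stmt-RiemannHypothesis-15969/15970/16980/2575 or the screw-neg landed
negatives (PivotFloor, LogFloorTail, ZeroDeficitTail, quadratic-form floors, uniform diagonal
margin) concerns aliased poles or LatticeCeiling; nothing refuted is re-wanted.

sub-problem: RiemannHypothesis · status: draft · opened planner-rh-idea-1-g0-0 2026-08-27T20:20:15Z · rev 0 · ledger route-RiemannHypothesis-ScrewPorousWall
GENERATED by the gate from the ledger (D-0016/17). Provers cite these decls: `theorem foo : Summit.RiemannHypothesis.RiemannHypothesis.Theses.ScrewPorousWall.<Decl> := …` in Summits/RiemannHypothesis/RiemannHypothesis/Theorems/<Name>.lean.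
-/

namespace Summit.RiemannHypothesis.RiemannHypothesis.Theses.ScrewPorousWall

open scoped BigOperators Topology Manifold Classical MeasureTheory ProbabilityTheory Matrix InnerProductSpace ComplexConjugate ContinuousMap
open Filter Set Function TopologicalSpace MeasureTheory

attribute [summit_statement] _root_.Summit.RiemannHypothesis

open Summit

/-- item stmt-RiemannHypothesis-21717 · crux · rank 2 · closed · proved by Summit.RiemannHypothesis.RiemannHypothesis.Theorems.Splittings.ScrewLatticePorous.noPorousPole_proof (prover) · by planner
why it might fail: Needs the fibre charge C_p ≠ 0 (sign-definiteness gives it) AND a near-tail bound ε(η)/κ over ALL poles q ≠ p within η; if other folded zeros q_m → p faster than their coefficients decay, the near/fibre split must be by ℓ¹-tails, not pointwise — Lean cost: tsum surgery.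
sources: corpus:book:ross2002-generalized-analytic-continuation p36-37, doi:10.1090/ulect/025, corpus:paper:doi-10-1155-aaa-2005-509 p2
[crux] RH-free theorem about ζ (the provable content). For every h > 0 with CEIL(h): for every
aliased pole p ∈ aliasedPoleSet h, every κ > 0 and every sequence z : ℕ → ℂ with z_n → p, z_n in the
connected component of 0 in 𝔻 ∖ closure(aliasedPoleSet h), and κ‖z_n − p‖ ≤ ‖q − z_n‖ for all n and
all q ∈ closure(aliasedPoleSet h) with q ≠ p — contradiction. Proof plan: F = B on Ω₀ (tree
`eqOn_of_preconnected`, `isPreconnected_connectedComponentIn`, `zero_mem_ball_diff_closure`); split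
B(z_n) = fibre(p) + near(η) + far(η) + regular; fibre = C_p·p/(p − z_n) (+ the u-side partner
bounded), |near| ≤ ε(η)/(κ‖z_n − p‖) by porosity, far and regular O_η(1) for ‖z_n − p‖ < η/2
(`exp_neg_half_le_norm_of_mem` keeps poles off 0); choose η with ε(η) < κ|C_p|‖p‖/2
(`summable_norm_coeff`); then |F(z_n)| → ∞, contradicting `ContinuousAt F p`. [difficulty: M] -/
@[route_item "route-RiemannHypothesis-ScrewPorousWall", crux]
def NoPorousPole : Prop :=
  ∀ h : ℝ, 0 < h → Theorems.Splittings.ScrewLatticeContinuation.LatticeCeiling h → ∀ p ∈ Theorems.Splittings.ScrewLatticeContinuation.aliasedPoleSet h, ∀ κ : ℝ, 0 < κ → ∀ z : ℕ → ℂ, Filter.Tendsto z Filter.atTop (nhds p) → (∀ n, z n ∈ connectedComponentIn (Metric.ball (0 : ℂ) 1 \ closure (Theorems.Splittings.ScrewLatticeContinuation.aliasedPoleSet h)) 0) → (∀ n, ∀ q ∈ closure (Theorems.Splittings.ScrewLatticeContinuation.aliasedPoleSet h), q ≠ p → κ * ‖z n - p‖ ≤ ‖q - z n‖) → False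

-- `NoPorousPole` holds: proved by `Summit.RiemannHypothesis.RiemannHypothesis.Theorems.Splittings.ScrewLatticePorous.noPorousPole_proof` (its module imports this route file, so no `_holds` link can be stated here).

/-- item stmt-RiemannHypothesis-21718 · crux · rank 3 · open · by planner
why it might fail: False iff ¬RH and EVERY folded far zero is non-porous from Ω₀: either a continuum of the wall separates all poles from 0 (B16′-type circle of accumulation) or each pole is wrapped in shells of other folded zeros with relative gaps → 0; ζ-side nothing is known.
sources: corpus:book:ross2002-generalized-analytic-continuation p33, doi:10.1090/ulect/025
[crux] The zero-side conjunct «A POROUSLY ACCESSIBLE FAR ZERO» at step h = 1 (the searchable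
object): if the aliased pole field aliasedPoleSet 1 is non-empty then some aliased pole p admits κ >
0 and a sequence z_n → p inside the origin's component of 𝔻 ∖ closure(aliasedPoleSet 1) with κ‖z_n −
p‖ ≤ ‖q − z_n‖ for every other wall point q. RH-implied (the field is empty under RH,
`aliasedPoleSet_eq_empty_of_rh`); implied by «finitely many off-line zeros» and by CountableClosure
(an isolated pole on ∂Ω₀ exists by Baire, tree §19 `exists_isolated_mem_closure` pattern); NOT
implied by ThinWall/DustWall and not implying them. [difficulty: open-problem] -/
@[route_item "route-RiemannHypothesis-ScrewPorousWall", crux]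
def PorousPole : Prop :=
  (Theorems.Splittings.ScrewLatticeContinuation.aliasedPoleSet 1).Nonempty → ∃ p ∈ Theorems.Splittings.ScrewLatticeContinuation.aliasedPoleSet 1, ∃ κ : ℝ, 0 < κ ∧ ∃ z : ℕ → ℂ, Filter.Tendsto z Filter.atTop (nhds p) ∧ (∀ n, z n ∈ connectedComponentIn (Metric.ball (0 : ℂ) 1 \ closure (Theorems.Splittings.ScrewLatticeContinuation.aliasedPoleSet 1)) 0) ∧ (∀ n, ∀ q ∈ closure (Theorems.Splittings.ScrewLatticeContinuation.aliasedPoleSet 1), q ≠ p → κ * ‖z n - p‖ ≤ ‖q - z n‖)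

/-- item stmt-RiemannHypothesis-21693 · support · rank 9 · open · by planner
sources: corpus:book:ross2002-generalized-analytic-continuation p33
[support] RESIDUAL conjunct (declared, NOT attacked by this line; RH-strength inside the real-weight
zero-side class by the blind models B14/B16/B16′ `ScrewLatticeWolffModel.exists_blind_model` /
`exists_blind_model_discrete`): CEIL(1) = LatticeCeiling 1, i.e. for every ε > 0 the screw function
satisfies |Ψ(k)| ≤ K_ε e^{εk} on k ∈ ℕ. RH ⟹ CEIL(1) is in the tree. Same decl as g16's L1 residual
up to the choice h = 1 (dedup by signature intended). [difficulty: open-problem] -/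
@[route_item "route-RiemannHypothesis-ScrewPorousWall", crux]
def Ceil : Prop :=
  Theorems.Splittings.ScrewLatticeContinuation.LatticeCeiling 1

/-- item stmt-RiemannHypothesis-21719 · assembly · rank 1 · closed · proved by Summit.RiemannHypothesis.RiemannHypothesis.Theorems.Splittings.ScrewLatticePorous.assembly_proof (prover) · by planner
sources: corpus:book:ross2002-generalized-analytic-continuation p36
[assembly] NoPorousPole → PorousPole → Ceil → RH (provable now; proof = Sketch.lean `closes`). -/
@[route_item "route-RiemannHypothesis-ScrewPorousWall", crux]
def Assembly : Prop :=
  NoPorousPole → PorousPole → Ceil → Summit.RiemannHypothesis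

-- `Assembly` holds: proved by `Summit.RiemannHypothesis.RiemannHypothesis.Theorems.Splittings.ScrewLatticePorous.assembly_proof` (its module imports this route file, so no `_holds` link can be stated here).

/-! D-0027 §2.1 — DECIDING THEOREM (planner-authored via `route open/edit --closes-file`; by planner-rh-idea-1-g0-0 2026-08-27T20:20:15Z):
its hypotheses are this route's items and its conclusion the sub-problem Statement (glue_lint), and it elaborates with this file. -/

@[closes "route-RiemannHypothesis-ScrewPorousWall"] theorem closes (h₁ : NoPorousPole) (h₂ : PorousPole) (h₃ : Ceil) (hA : Assembly) : Summit.RiemannHypothesis :=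
  hA h₁ h₂ h₃

end Summit.RiemannHypothesis.RiemannHypothesis.Theses.ScrewPorousWall
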